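import Literature.AlgebraicGeometry.HodgeTheory.InvariantClassesFromTotalSpace
import Literature.AlgebraicGeometry.HodgeTheory.RelativeHyperplaneClassHodgeRiemann
import Literature.AlgebraicGeometry.HodgeTheory.HyperplaneClassHardLefschetzPullback
import Literature.AlgebraicGeometry.HodgeTheory.HyperplaneClassRational
import Literature.AlgebraicGeometry.Motives.HodgeStructureDirectSum
import HarnessLib

/-!
# Lefschetz algebra: maps intertwining two Lefschetz operators commute with the primitive parts;
# the cup-product bridge `(L^{n-a} u) ∪ ξ_P x = (L^{n-a-t} u) ∪ x`

Family `hodge`, layer `Literature/AlgebraicGeometry/HodgeTheory`, sub-namespace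
`…HodgeTheory.SmoothFamilyGysinKernel`. THEOREMS ONLY (no definition, no named fact). First file of the
Literature home of the discharge of `Deligne1971_fibreGysin_injOn_restricted` (`SmoothFamilyFibreClasses`;
apex `SmoothFamilyGysinKernelHolds`).

LEFSCHETZ ALGEBRA on `H•(Y; R)` (any space, any commutative ring): additive maps `T : H•(Y₁) → H•(Y₂)`
intertwining two Lefschetz operators commute with the Lefschetz iterates (`map_lefschetzPowTo_of_semiconj`),
preserve primitive classes (`map_mem_primitiveClasses_of_semiconj`) and COMMUTE WITH THE PRIMITIVE PARTS
`ξ_P` of the two Lefschetz decompositions (`map_primitivePart_of_semiconj`; the tree's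
`map_primitivePart_of_commute` is the case `Y₁ = Y₂`); `primitivePart_congr`; all powers of `κ` may be moved
onto the first cup factor (`cupProduct_lefschetzPowTo_lefschetzPowTo_left`); and the identity
**`(L^{n-a} u) ∪ ξ_P x = (L^{n-a-t} u) ∪ x`** in `H^{2n}` for `u` primitive of degree `a`, `P = (a, t)`
(`cupProduct_lefschetzPowTo_primitivePart_eq`: the other Lefschetz components of `x` are orthogonal to `u`,
Voisin I Lemma 6.29 / proof of Thm. 6.32) — the bridge between the polarisation form and the plain cup
product. Also the rational-structure lemma `baseChange_mem_baseChange_range` (`g_ℂ x ∈ (im g)_ℂ`).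

Provenance: Literature home of the Summits-side `Theorems/Ring2AbelianAllAndreFibreClassPrimitiveParts` §1
and `…FibreClassKernelOfDeligne` §RationalStructure (cell Ring 2 · AbelianAll, André axis), which
`Literature/` may not import. Lane `lit-hodgefound`, seat p20.

## References

* [VoisinHodgeI2002] C. Voisin, Hodge Theory and Complex Algebraic Geometry I, CUP 2002, §6.2.3, Cor. 6.26,
  Lemma 6.29, Thm. 6.32, §7.1.1–7.1.2.
* [HatcherAT2002] A. Hatcher, Algebraic Topology, CUP 2002, §3.2 p. 211 and Thm. 3.11.
-/

noncomputable section

open CategoryTheory AlgebraicGeometry MonoidalCategory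
open scoped TensorProduct
open _root_.Topology _root_.Filter
open Literature.AlgebraicGeometry Literature.AlgebraicGeometry.Motives
open Literature.AlgebraicGeometry.HodgeTheory
open Literature.AlgebraicTopology.SingularHomology (singularCohomology cupProduct cupProduct_map)
open Literature.Geometry.Kaehler (lefschetzOperator HasHardLefschetzProperty)

namespace Literature.AlgebraicGeometry.HodgeTheory.SmoothFamilyGysinKernel

universe u v

/-! ## §1 Lefschetz algebra: maps intertwining two Lefschetz operators; the cup-product bridge -/

section LefschetzAlgebra

variable {Y₁ Y₂ : Type u} [TopologicalSpace Y₁] [TopologicalSpace Y₂] {R : Type v} [CommRing R]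
variable {κ₁ : singularCohomology R R Y₁ 2} {κ₂ : singularCohomology R R Y₂ 2} {n : ℕ}

/-- **Additive maps intertwining the Lefschetz operators of `(Y₁, κ₁)` and `(Y₂, κ₂)` intertwine their
iterates** (`T (L₁ʲ x) = L₂ʲ (T x)`; the two-space form of the tree's `map_lefschetzPowTo_of_commute`).
[cite: VoisinHodgeI2002, §6.2.3] -/
theorem map_lefschetzPowTo_of_semiconj
    (T : ∀ a, singularCohomology R R Y₁ a →+ singularCohomology R R Y₂ a)
    (hT : ∀ (k l : ℕ) (h : 2 + k = l) (x : singularCohomology R R Y₁ k),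
      T l (lefschetzOperator κ₁ h x) = lefschetzOperator κ₂ h (T k x)) :
    ∀ (t a m : ℕ) (h : a + 2 * t = m) (x : singularCohomology R R Y₁ a),
      T m (lefschetzPowTo κ₁ t a m h x) = lefschetzPowTo κ₂ t a m h (T a x)
  | 0, a, m, h, x => by
    subst h
    rfl
  | t + 1, a, m, h, x => by
    rw [lefschetzPowTo_succ_apply κ₁ t a (a + 2 * t) m rfl h (by omega),
      lefschetzPowTo_succ_apply κ₂ t a (a + 2 * t) m rfl h (by omega), hT,
      map_lefschetzPowTo_of_semiconj T hT t a (a + 2 * t) rfl x]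

/-- Such maps carry `κ₁`-primitive classes to `κ₂`-primitive classes (same dimension `n`).
[cite: VoisinHodgeI2002, §6.2.3 Def. 6.24] -/
theorem map_mem_primitiveClasses_of_semiconj
    (T : ∀ a, singularCohomology R R Y₁ a →+ singularCohomology R R Y₂ a)
    (hT : ∀ (k l : ℕ) (h : 2 + k = l) (x : singularCohomology R R Y₁ k),
      T l (lefschetzOperator κ₁ h x) = lefschetzOperator κ₂ h (T k x))
    {a : ℕ} {x : singularCohomology R R Y₁ a} (hx : x ∈ primitiveClasses κ₁ n a) :
    T a x ∈ primitiveClasses κ₂ n a :=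
  ⟨fun ha ↦ by rw [hx.1 ha, map_zero],
    fun r m h hr ↦ by rw [← map_lefschetzPowTo_of_semiconj T hT r a m h x, hx.2 r m h hr, map_zero]⟩

/-- **Such maps commute with the primitive parts of the two Lefschetz decompositions**:
`T (ξ_P x) = ξ_P (T x)` (uniqueness of the Lefschetz decomposition of `T x`, Voisin I Cor. 6.26).
[cite: VoisinHodgeI2002, §6.2.3 Cor. 6.26] -/
theorem map_primitivePart_of_semiconj (hL₁ : HasHardLefschetzProperty κ₁ n)
    (hvan₁ : ∀ m, 2 * n < m → Subsingleton (singularCohomology R R Y₁ m))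
    (hL₂ : HasHardLefschetzProperty κ₂ n)
    (hvan₂ : ∀ m, 2 * n < m → Subsingleton (singularCohomology R R Y₂ m))
    (T : ∀ a, singularCohomology R R Y₁ a →+ singularCohomology R R Y₂ a)
    (hT : ∀ (k l : ℕ) (h : 2 + k = l) (x : singularCohomology R R Y₁ k),
      T l (lefschetzOperator κ₁ h x) = lefschetzOperator κ₂ h (T k x))
    {i : ℕ} (p : {p : ℕ × ℕ // p.1 + 2 * p.2 = i}) (x : singularCohomology R R Y₁ i) :
    T p.1.1 (primitivePart κ₁ n hL₁ hvan₁ p x) = primitivePart κ₂ n hL₂ hvan₂ p (T i x) := by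
  classical
  symm
  refine primitivePart_eq_of_sum_eq hL₂ hvan₂
    (y := fun q ↦ T q.1.1 (primitivePart κ₁ n hL₁ hvan₁ q x))
    (fun q ↦ map_mem_primitiveClasses_of_semiconj T hT (primitivePart_mem hL₁ hvan₁ q x))
    (fun q hq ↦ by rw [primitivePart_of_lt hL₁ hvan₁ q hq, LinearMap.zero_apply, map_zero]) ?_ p
  calc ∑ q : {p : ℕ × ℕ // p.1 + 2 * p.2 = i},
        lefschetzPowTo κ₂ q.1.2 q.1.1 i q.2 (T q.1.1 (primitivePart κ₁ n hL₁ hvan₁ q x))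
      = ∑ q : {p : ℕ × ℕ // p.1 + 2 * p.2 = i},
          T i (lefschetzPowTo κ₁ q.1.2 q.1.1 i q.2 (primitivePart κ₁ n hL₁ hvan₁ q x)) :=
        Finset.sum_congr rfl fun q _ ↦ (map_lefschetzPowTo_of_semiconj T hT _ _ _ _ _).symm
    _ = T i (∑ q : {p : ℕ × ℕ // p.1 + 2 * p.2 = i},
          lefschetzPowTo κ₁ q.1.2 q.1.1 i q.2 (primitivePart κ₁ n hL₁ hvan₁ q x)) := (map_sum (T i) _ _).symm
    _ = T i x := by rw [sum_lefschetzPowTo_primitivePart hL₁ hvan₁ x]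

/-- The primitive parts depend on the class `κ` only (not on the chosen proofs): rewriting along an
equality of classes. [cite: VoisinHodgeI2002, §6.2.3] -/
theorem primitivePart_congr {Y : Type u} [TopologicalSpace Y] {κ κ' : singularCohomology R R Y 2}
    (e : κ = κ') (hL : HasHardLefschetzProperty κ n) (hL' : HasHardLefschetzProperty κ' n)
    (hvan : ∀ m, 2 * n < m → Subsingleton (singularCohomology R R Y m))
    {i : ℕ} (p : {p : ℕ × ℕ // p.1 + 2 * p.2 = i}) (x : singularCohomology R R Y i) :
    primitivePart κ n hL hvan p x = primitivePart κ' n hL' hvan p x := by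
  subst e
  rfl

variable {Y : Type u} [TopologicalSpace Y] (κ : singularCohomology R R Y 2)

/-- `(Lⁱ u) ∪ (Lʲ v) = (L^{i+j} u) ∪ v`: all powers of `κ` may be moved onto the FIRST factor (companion of the
tree's `cupProduct_lefschetzPowTo_lefschetzPowTo`, which moves them onto the second).
[cite: HatcherAT2002, §3.2 p. 211 and Thm. 3.11] -/
theorem cupProduct_lefschetzPowTo_lefschetzPowTo_left (i j : ℕ) {p k a b s c : ℕ} (ha : p + 2 * i = a)
    (hb : k + 2 * j = b) (hs : a + b = s) (hc : p + 2 * (i + j) = c) (hs' : c + k = s)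
    (u : singularCohomology R R Y p) (v : singularCohomology R R Y k) :
    cupProduct hs (lefschetzPowTo κ i p a ha u) (lefschetzPowTo κ j k b hb v) =
      cupProduct hs' (lefschetzPowTo κ (i + j) p c hc u) v := by
  rw [cupProduct_lefschetzPowTo_right κ j hb hs (rfl : a + k = a + k) (by omega)
      (lefschetzPowTo κ i p a ha u) v,
    cupProduct_lefschetzPowTo_left κ i ha rfl (rfl : p + k = p + k) (by omega) u v,
    lefschetzPowTo_lefschetzPowTo κ j (by omega) (by omega) (by omega),
    cupProduct_lefschetzPowTo_left κ (i + j) hc hs' rfl (by omega) u v]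

/-- **The cup-product bridge** (Voisin I Lemma 6.29, proof of Thm. 6.32): for `u ∈ Pᵃ` primitive, a
Lefschetz index `P = (a, t)` of degree `i = a + 2t` with `a + t ≤ n`, and ANY `x ∈ Hⁱ(Y; R)`,
`(L^{n-a} u) ∪ ξ_P x = (L^{n-a-t} u) ∪ x` in `H^{2n}(Y; R)`: in the Lefschetz decomposition
`x = ∑_{P'} L^{t'} ξ_{P'} x` the components with `P' ≠ P` (primitive degree `a' ≠ a`) are killed, after moving
all powers of `κ` onto the factor of larger primitive degree, by `L^{n-a+1} Pᵃ = 0`. The primitive part of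
`x` of index `P` is thereby read off by a plain cup product. [cite: VoisinHodgeI2002, §6.2.3 Lemma 6.29 and §6.3.2 Thm. 6.32]
[cite: HatcherAT2002, §3.2 Thm. 3.11] -/
theorem cupProduct_lefschetzPowTo_primitivePart_eq (hL : HasHardLefschetzProperty κ n)
    (hvan : ∀ m, 2 * n < m → Subsingleton (singularCohomology R R Y m))
    {i : ℕ} (P : {p : ℕ × ℕ // p.1 + 2 * p.2 = i})
    {u : singularCohomology R R Y P.1.1} (hu : u ∈ primitiveClasses κ n P.1.1)
    (x : singularCohomology R R Y i) {s m s' q : ℕ} (hs : P.1.1 + s = n) (hm : P.1.1 + 2 * s = m)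
    (h : m + P.1.1 = 2 * n) (hs' : P.1.1 + P.1.2 + s' = n) (hq : P.1.1 + 2 * s' = q) (h' : q + i = 2 * n) :
    cupProduct h (lefschetzPowTo κ s P.1.1 m hm u) (primitivePart κ n hL hvan P x) =
      cupProduct h' (lefschetzPowTo κ s' P.1.1 q hq u) x := by
  classical
  obtain ⟨⟨a, t⟩, hP⟩ := P
  dsimp only at hu hs hm h hs' hq hm ⊢
  conv_rhs => rw [← sum_lefschetzPowTo_primitivePart hL hvan x]
  rw [map_sum, Finset.sum_eq_single ⟨(a, t), hP⟩]
  · -- the `P`-term: `(L^{s'} u) ∪ (Lᵗ ξ) = (L^{s'+t} u) ∪ ξ = (Lˢ u) ∪ ξ`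
    rw [cupProduct_lefschetzPowTo_lefschetzPowTo_left κ s' t hq hP h' (by omega : a + 2 * (s' + t) = m) h u]
    exact congrArg (fun z ↦ cupProduct h z _) (lefschetzPowTo_congr_exponent κ (by omega) _ _ u)
  · -- the other terms vanish
    rintro ⟨⟨a', t'⟩, hP'⟩ - hne
    have hne' : a' ≠ a := by
      rintro rfl
      obtain rfl : t' = t := by omega
      exact hne rfl
    set v := primitivePart κ n hL hvan ⟨(a', t'), hP'⟩ x with hv
    have hvprim : v ∈ primitiveClasses κ n a' := primitivePart_mem hL hvan ⟨(a', t'), hP'⟩ x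
    dsimp only
    rcases lt_or_gt_of_ne hne' with hlt | hgt
    · -- `a' < a`: move the powers onto `u`, of degree `a`: `L^{s'+t'} u = 0`
      rw [cupProduct_lefschetzPowTo_lefschetzPowTo_left κ s' t' hq hP' h'
          (rfl : a + 2 * (s' + t') = a + 2 * (s' + t')) (by omega) u v,
        lefschetzPowTo_eq_zero_of_mem_primitiveClasses hu _ (by omega), LinearMap.map_zero,
        LinearMap.zero_apply]
    · -- `a' > a`: move the powers onto `v`, of degree `a'`: `L^{s'+t'} v = 0`
      rw [cupProduct_lefschetzPowTo_lefschetzPowTo κ s' t' hq hP' h'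
          (rfl : a' + 2 * (s' + t') = a' + 2 * (s' + t')) (by omega) u v,
        lefschetzPowTo_eq_zero_of_mem_primitiveClasses hvprim _ (by omega), LinearMap.map_zero]
  · intro hP0
    exact absurd (Finset.mem_univ _) hP0

end LefschetzAlgebra

/-! ## Rational structures: base change of ranges -/

section RationalStructure

variable {V V' : Type} [AddCommGroup V] [Module ℚ V] [AddCommGroup V'] [Module ℚ V']

/-- `g_ℂ x ∈ (im g)_ℂ` for a `ℚ`-linear `g` and every `x ∈ ℂ ⊗ V'`. [cite: VoisinHodgeI2002, §7.1.1] -/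
theorem baseChange_mem_baseChange_range (g : V' →ₗ[ℚ] V) (x : ℂ ⊗[ℚ] V') :
    g.baseChange ℂ x ∈ (LinearMap.range g).baseChange ℂ := by
  induction x using TensorProduct.induction_on with
  | zero => rw [map_zero]; exact Submodule.zero_mem _
  | tmul c v =>
    rw [LinearMap.baseChange_tmul]
    exact Submodule.tmul_mem_baseChange_of_mem c (LinearMap.mem_range_self g v)
  | add x y hx hy => rw [map_add]; exact Submodule.add_mem _ hx hy

end RationalStructure

end Literature.AlgebraicGeometry.HodgeTheory.SmoothFamilyGysinKernel

end
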